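import Summits.QuantumFields.YangMills.Theorems.PoincareLipschitzMeanOfMedian
import Summits.QuantumFields.YangMills.Theorems.PoincareLipschitzMedianCentringLocalTailOfMedianStub
import Summits.QuantumFields.YangMills.Theses.RevelationMartingale
import HarnessLib

/-!
# Route `PoincareLipschitz` ∕ LINE 27 «MedianCentring» — helper T-4: THE REGISTERED TARGET `RevelationMartingale.MeanDeviationShallowL`
# (stmt-QuantumFields-23133) FROM K1, K2 AND THE 3/4-QUANTILE — the skeleton's `MeanDeviationShallowL_of` with BOTH landed stubs traded for theorems

The registered skeleton `Cruxes/HistoryTailL/Lines/median_centring.lean` (ideator ym-r3-idea-2 g15) composes its target BY NAME as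
`MeanDeviationShallowL_of (hC)(hLip) := … stub_meanOfMedian hC hLip stub_quantileDeviation (stub_localTailOfMedian hC hLip stub_quantileDeviation) …`
with depth fraction `N₁ := 3` (`1 ≤ j ∧ 3j ≤ K ⇒ j + 2 ≤ K`).  Two of the three stubs are now tree theorems — (T) ✓`…LocalTailOfMedianStub.stub_localTailOfMedian`
(px10 g6, p724621) and (M) ✓`PoincareLipschitz.MedianCentring.stub_meanOfMedian` (px19 g7, p725277) — so the target holds from K1 `MesoscopicConcentrationL`,
K2 `BlockLipschitzL` and the ONE open stub (Q) `stub_quantileDeviation` taken as a hypothesis: this file is that 10-line composition, i.e. the door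
«`MeanDeviationShallowL` modulo {K1, K2, QUANTILE}».  (The ideator's one-file Cruxes reduction `median_centring_closed.lean` states the same; Cruxes modules are
not importable under `Theorems/`, hence this by-name door over the landed Theorems files.)

Width seat ym3-torus-px10 g6 (cell ym3-torus, WIDTH COPY «width 10»), `--supports stmt-QuantumFields-23133`.  Conditional on K1, K2, (Q) — all OPEN; the
item stmt-QuantumFields-23133 is NOT closed by this file (audit: `proof.conditional`), no crux, rung (R3 = YM₃ on T³; NOT d = 4, NOT infinite volume, NOT a mass
gap, NOT Clay) or summit is proved; the Yang–Mills mass gap is NOT proved.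
-/

set_option autoImplicit false

namespace Summit.QuantumFields.YangMills.Theorems.PoincareLipschitz.MedianCentring

open MeasureTheory
open scoped BigOperators
open Literature.MathematicalPhysics.QuantumFieldTheory.Balaban1983to89
open Literature.MathematicalPhysics.QuantumFieldTheory.Balaban1983to89.T3ContinuumYM3Torus
open Literature.MathematicalPhysics.QuantumFieldTheory.Balaban1983to89.T3UnitScaleTilt
open Literature.MathematicalPhysics.QuantumFieldTheory.Balaban1983to89.T3UnitLawDensityEML (ℰp measurableE_ℰp)

/-- ★★★ **DOOR «`MeanDeviationShallowL` MODULO {K1, K2, QUANTILE}»**: the registered target of LINE 27, `RevelationMartingale.MeanDeviationShallowL`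
(stmt-QuantumFields-23133) with `N₁ := 3`, from `MesoscopicConcentrationL`, `BlockLipschitzL` and the 3/4-quantile bound (Q) — the skeleton's
`MeanDeviationShallowL_of` with (T) := ✓`stub_localTailOfMedian` and (M) := ✓`stub_meanOfMedian` by name.
[cite: Balaban1985UV3, (7) p.257 and (71) p.273; Ledoux2001, Prop. 1.3] -/
theorem meanDeviationShallowL_of_quantile
    (hC : Summit.QuantumFields.YangMills.Theses.PoincareLipschitz.MesoscopicConcentrationL)
    (hLip : Summit.QuantumFields.YangMills.Theses.PoincareLipschitz.BlockLipschitzL)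
    (hQ : ∀ (L : ℕ) (b₀ p₀ : ℝ), 0 < b₀ → 2 < p₀ → ∃ γ₁ : ℝ, 0 < γ₁ ∧ γ₁ ≤ 1 ∧ ∀ (F : T3Family) (γ : ℝ), F.L = L → 0 < γ → γ ≤ γ₁ →
            ∀ (K j : ℕ), 1 ≤ j → j + 2 ≤ K → ∀ a : Plaq (F.P K) j,
              3 / 4 ≤ (gibbsK F ℰp γ K).real {U : GaugeField (F.P K) 0 (Matrix.specialUnitaryGroup (Fin 2) ℂ) | GaugeGroup.dist1 (GaugeField.plaqHol (Averaging.iter (fun i' => BlockAveraging.blockAvg (P := F.P K) (j := i') ℰp) j U) a) ≤ θBal F.L γ b₀ p₀ (K - j) / 8}) :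
    Summit.QuantumFields.YangMills.Theses.RevelationMartingale.MeanDeviationShallowL := by
  intro L
  refine ⟨3, by norm_num, fun b₀ p₀ hb₀ hp₀ => ?_⟩
  obtain ⟨γ₁, hγ₁, hγ₁1, H⟩ := stub_meanOfMedian hC hLip hQ
    (Summit.QuantumFields.YangMills.Theorems.PoincareLipschitzMedianCentringLocalTailOfMedianStub.stub_localTailOfMedian hC hLip hQ)
    L b₀ p₀ hb₀ hp₀
  exact ⟨γ₁, hγ₁, hγ₁1, fun F γ hFL hγ hγle K j hj hjK a => H F γ hFL hγ hγle K j hj (by omega) a⟩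

end Summit.QuantumFields.YangMills.Theorems.PoincareLipschitz.MedianCentring
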